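import Literature.AlgebraicGeometry.HodgeTheory.FermatSurfaceLinesRepresent
import HarnessLib

/-!
# The character-sum criterion behind "cones represent `α∗β`": `π_δ x ≠ 0` from twisted restriction numbers

Family `hodge`, layer `Literature/AlgebraicGeometry/HodgeTheory`. PROOF FILE (theorems only; no
definition, no named fact). The algebraic half of the cone-span leaves
`Shioda1979_coneSpan_represents_left/right` of Aoki's Thm. 1-4 (i) (`FermatJuxtapositionSpans`;
N. Aoki, J. Math. Soc. Japan 39 (1987), Thm. 1-4 (i) with `r = 0`, p. 388; T. Shioda, Math. Ann. 245
(1979), Thm. I; Z. Ran, Compositio Math. 42 (1980), Prop. 1.14 — the eigenvalues of the circulant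
intersection matrices of the induced cycles), in the form in which the lines leaf was proved
(`FermatSurface.fermatProjector_lineClass_ne_zero`, `FermatSurfaceLinesRepresent`), for an
ARBITRARY dimension `n`, degree `k` and pair of "vertex" slots `i₀ ≠ i₁`:

* `fermatCharacter_add`, `fermatCharacter_single` — `χ_{α+β} = χ_α χ_β` on `μₘⁿ⁺²` and
  `χ_{c eᵢ}(a) = aᵢ^{⟨c⟩}`;
* `fermatGroupSingle_apply_of_ne'`, `sum_inv_fermatCharacter_mul_indicator_eq_zero'` — the
  general-`n` forms of the two lemmas of `FermatSurfaceLinesRepresent` (a twisted indicator sum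
  `Σ_a χ(a)⁻¹ [P a]` over `μₘⁿ⁺²` vanishes when `P` is invariant under a translation `g` with
  `χ(g) ≠ 1`);
* `fermatProjector_ne_zero_of_twisted_restrictions` — **the criterion**: let `δ` be a character of
  `Xⁿₘ` with `δ_{i₀} ≠ 0`, `δ_{i₀} + δ_{i₁} = 0`, and `δ'` the character with the slots `i₀, i₁`
  zeroed. If a `ℂ`-linear map `Λ` on `Hᵏ(Xⁿₘ(ℂ); ℂ)` takes the translates `g_a^* x` of a class `x`
  to `(χ_{δ'}(a) · c(a)) • A` with `A ≠ 0` and `c(a) = s` or `t` according as `a_{i₀} = a_{i₁}` or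
  not, with `s ≠ t`, then `π_δ x ≠ 0`. Proof: `Λ(π_δ x) = |G|⁻¹ (Σ_a χ_δ(a)⁻¹ χ_{δ'}(a) c(a)) • A`,
  `χ_δ⁻¹ χ_{δ'} = ψ⁻¹` for `ψ = χ_{δ_{i₀} e_{i₀} + δ_{i₁} e_{i₁}}`, `Σ_a ψ(a)⁻¹ = 0` (`ψ ≠ 1`) and
  `Σ_a ψ(a)⁻¹ [a_{i₀} = a_{i₁}] = N = #{a | a_{i₀} = a_{i₁}} ≠ 0` (`ψ = 1` there), so
  `Λ(π_δ x) = |G|⁻¹ (s - t) N • A ≠ 0`.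

Intended use (the geometric half, NOT in this file): for the `m` cones `C_ε(w)` over a class
`w ∈ V(β)` of `X²ˢₘ = {z_{i₀} = z_{i₁} = 0} ∩ X^{2s+2}ₘ` with vertices `v_ε` on the line
`{z_j = 0, j ≠ i₀, i₁}`, `x = cl C_1(w)`, `g_a^* x = χ_β(a_x) cl C_{ε(a)}(w)` and
`Λ = π_* ∘ φ_1^*` (restriction to the reference cone followed by integration to the base) takes the
value `κ_self • w` on the reference cone (`a_{i₀} = a_{i₁}`) and `κ • w` on the other cones, which
meet it along the base; the criterion then says `π_{α∗β} cl C_1(w) ≠ 0` as soon as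
`κ_self ≠ κ` — in print the eigenvalue `-m` of the intersection matrix on a non-trivial character of
the vertex group.

## References

* [Aoki1987] N. Aoki, Some new algebraic cycles on Fermat varieties, J. Math. Soc. Japan 39 (1987),
  Thm. 1-4 (i) p. 388, p. 386.
* [Shioda1979HodgeFermat] T. Shioda, The Hodge conjecture for Fermat varieties, Math. Ann. 245
  (1979), §1 and Thm. I.
* [Ran1980] Z. Ran, Cycles on Fermat hypersurfaces, Compositio Math. 42 (1980), §1 Prop. 1.14.
* [SerreLinearRepresentations1977] J.-P. Serre, Linear Representations of Finite Groups, §2.6 Thm. 8.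
-/

noncomputable section

open CategoryTheory AlgebraicGeometry
open Literature.AlgebraicGeometry.Motives Literature.AlgebraicTopology.SingularHomology

namespace Literature.AlgebraicGeometry.HodgeTheory

variable {n m : ℕ}

/-! ### Characters of `μₘⁿ⁺²` -/

/-- **`χ_{α+β} = χ_α · χ_β`** on `μₘⁿ⁺²`: `aᵢ^{⟨αᵢ+βᵢ⟩} = aᵢ^{⟨αᵢ⟩+⟨βᵢ⟩}` as `aᵢᵐ = 1` and the
exponents agree modulo `m`. [cite: Shioda1979HodgeFermat, §1] -/
theorem fermatCharacter_add [NeZero m] (α β : Fin (n + 2) → ZMod m) :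
    fermatCharacter m (α + β) = fermatCharacter m α * fermatCharacter m β := by
  ext a : 1
  rw [MonoidHom.mul_apply, fermatCharacter_apply, fermatCharacter_apply, fermatCharacter_apply,
    ← Finset.prod_mul_distrib]
  refine Finset.prod_congr rfl fun i _ ↦ ?_
  have hai : (a : Fin (n + 2) → ℂˣ) i ^ m = 1 := mem_fermatGroup_iff.mp a.2 i
  have hmod : ∀ q : ℕ, (a : Fin (n + 2) → ℂˣ) i ^ q = (a : Fin (n + 2) → ℂˣ) i ^ (q % m) := fun q ↦ by
    conv_lhs => rw [← Nat.mod_add_div q m, pow_add, pow_mul, hai, one_pow, mul_one]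
  rw [← pow_add, Pi.add_apply, ZMod.val_add, ← hmod]

/-- **`χ_{c·eᵢ}(a) = aᵢ^{⟨c⟩}`** for the character supported on one slot. [cite: Shioda1979HodgeFermat, §1] -/
theorem fermatCharacter_single (i : Fin (n + 2)) (c : ZMod m) (a : fermatGroup n m) :
    fermatCharacter m (Pi.single i c) a = (a : Fin (n + 2) → ℂˣ) i ^ c.val := by
  classical
  rw [fermatCharacter_apply, Finset.prod_eq_single i]
  · rw [Pi.single_eq_same]
  · intro j _ hj
    rw [Pi.single_eq_of_ne hj, ZMod.val_zero, pow_zero]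
  · intro h
    exact absurd (Finset.mem_univ i) h

/-- The element `(1, …, ζ, …, 1)` has coordinate `1` off the slot `i` (general `n`; the tree's
`FermatSurface.fermatGroupSingle_apply_of_ne` is the case `n = 2`). [folklore] -/
theorem fermatGroupSingle_apply_of_ne' (i j : Fin (n + 2)) (hij : j ≠ i) (ζ : rootsOfUnity m ℂ) :
    ((fermatGroupSingle (n := n) i ζ : fermatGroup n m) : Fin (n + 2) → ℂˣ) j = 1 := by
  -- adapted from FermatSurface.fermatGroupSingle_apply_of_ne (FermatSurfaceLinesRepresent)
  rw [fermatGroupSingle, fermatGroupEquiv_apply_coe, Pi.mulSingle_eq_of_ne hij]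
  rfl

/-- The element `(1, …, ζ, …, 1)` has coordinate `ζ` in the slot `i`. [folklore] -/
theorem fermatGroupSingle_apply_self (i : Fin (n + 2)) (ζ : rootsOfUnity m ℂ) :
    ((fermatGroupSingle (n := n) i ζ : fermatGroup n m) : Fin (n + 2) → ℂˣ) i = (ζ : ℂˣ) := by
  rw [fermatGroupSingle, fermatGroupEquiv_apply_coe, Pi.mulSingle_eq_same]

/-- **A twisted indicator sum over `μₘⁿ⁺²` vanishes** (general `n`): if `P` is invariant under right
translation by `g` and `χ(g) ≠ 1` then `Σ_a χ(a)⁻¹ [P a] = 0` (reindex `a ↦ a g`).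
[cite: SerreLinearRepresentations1977, §2.6 Thm. 8] -/
theorem sum_inv_fermatCharacter_mul_indicator_eq_zero' [NeZero m] (χ : fermatGroup n m →* ℂˣ)
    (P : fermatGroup n m → Prop) [DecidablePred P] (g : fermatGroup n m)
    (hP : ∀ a, P (a * g) ↔ P a) (hg : χ g ≠ 1) :
    ∑ a, ((χ a : ℂˣ) : ℂ)⁻¹ * (if P a then 1 else 0) = 0 := by
  -- adapted from FermatSurface.sum_inv_fermatCharacter_mul_indicator_eq_zero (FermatSurfaceLinesRepresent)
  set T := ∑ a, ((χ a : ℂˣ) : ℂ)⁻¹ * (if P a then (1 : ℂ) else 0) with hT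
  have hre : T = ((χ g : ℂˣ) : ℂ)⁻¹ * T := by
    rw [hT, Finset.mul_sum]
    refine (Fintype.sum_equiv (Equiv.mulRight g) _ _ fun a ↦ ?_).symm
    rw [Equiv.coe_mulRight, map_mul, Units.val_mul, mul_inv, if_congr (hP a) rfl rfl]
    ring
  have hg' : ((χ g : ℂˣ) : ℂ)⁻¹ ≠ 1 := by
    rw [Ne, inv_eq_one, Units.val_eq_one]
    exact hg
  have h : (1 - ((χ g : ℂˣ) : ℂ)⁻¹) * T = 0 := by rw [sub_mul, one_mul, ← hre, sub_self]
  exact (mul_eq_zero.mp h).resolve_left (sub_ne_zero.mpr (Ne.symm hg'))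

/-! ### The criterion -/

/-- **`π_δ x ≠ 0` from twisted restriction numbers.** Let `δ` be a character of `Xⁿₘ` with
`δ_{i₀} ≠ 0` and `δ_{i₀} + δ_{i₁} = 0` (`i₀ ≠ i₁`), and `δ'` agree with `δ` off `i₀, i₁` and vanish
there. Suppose a `ℂ`-linear `Λ : Hᵏ(Xⁿₘ(ℂ); ℂ) → V` takes the translates of a class `x` to
`Λ(g_a^* x) = (χ_{δ'}(a) · c_a) • A`, `A ≠ 0`, where `c_a = s` if `a_{i₀} = a_{i₁}` and `c_a = t`
otherwise, `s ≠ t`. Then `π_δ x ≠ 0`: `Λ(π_δ x) = |G|⁻¹ (Σ_a ψ(a)⁻¹ c_a) • A` with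
`ψ = χ_δ χ_{δ'}⁻¹ = χ_{δ_{i₀} e_{i₀} + δ_{i₁} e_{i₁}}`, and `Σ_a ψ(a)⁻¹ c_a = (s - t) N`,
`N = #{a | a_{i₀} = a_{i₁}} ≠ 0`, because `Σ_a ψ(a)⁻¹ = 0` (`ψ(1, …, ζ_{i₀}, …, 1) = ζ^{⟨δ_{i₀}⟩} ≠ 1`)
and `ψ(a) = a_{i₀}^{⟨δ_{i₀}⟩ + ⟨δ_{i₁}⟩} = 1` when `a_{i₀} = a_{i₁}` (`m ∣ ⟨δ_{i₀}⟩ + ⟨δ_{i₁}⟩`). For the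
cones of Aoki's Thm. 1-4 (i) (`r = 0`): `x` the class of a cone, `Λ` the restriction to it followed
by integration to the base, `s, t` the self and transversal restriction numbers — the eigenvalue
computation of Ran's Prop. 1.14 on the character `δ_{i₀}` of the vertex group.
[cite: Aoki1987, Thm. 1-4 (i) p. 388 and p. 386] [cite: Ran1980, §1 Prop. 1.14]
[cite: SerreLinearRepresentations1977, §2.6 Thm. 8] -/
theorem fermatProjector_ne_zero_of_twisted_restrictions [NeZero m] {k : ℕ}
    (δ δ' : Fin (n + 2) → ZMod m) {i₀ i₁ : Fin (n + 2)} (h01 : i₀ ≠ i₁) (hδ : δ i₀ ≠ 0)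
    (hsum : δ i₀ + δ i₁ = 0) (hδ'₀ : δ' i₀ = 0) (hδ'₁ : δ' i₁ = 0)
    (hδ' : ∀ j, j ≠ i₀ → j ≠ i₁ → δ' j = δ j)
    (x : complexBetti (fermatHypersurface n m) k)
    {V : Type*} [AddCommGroup V] [Module ℂ V] (Λ : complexBetti (fermatHypersurface n m) k →ₗ[ℂ] V)
    {A : V} (hA : A ≠ 0) {s t : ℂ} (hst : s ≠ t)
    (hΛ : ∀ a : fermatGroup n m,
      Λ (singularCohomology.map ℂ ℂ
          (diagonalMap (fermatPolynomial ℂ n m) (fermatGroup_le_diagonalStabilizer m a.2)) k x) =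
        (((fermatCharacter m δ' a : ℂˣ) : ℂ) *
          (if (a : Fin (n + 2) → ℂˣ) i₀ = (a : Fin (n + 2) → ℂˣ) i₁ then s else t)) • A) :
    fermatProjector m δ k x ≠ 0 := by
  classical
  -- the vertex character `ψ = χ_θ`, `θ = δ_{i₀} e_{i₀} + δ_{i₁} e_{i₁}`, with `δ = δ' + θ`
  set θ : Fin (n + 2) → ZMod m := Pi.single i₀ (δ i₀) + Pi.single i₁ (δ i₁) with hθ
  have hδθ : δ = δ' + θ := by
    funext j
    simp only [hθ, Pi.add_apply]
    by_cases hj0 : j = i₀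
    · subst hj0
      rw [hδ'₀, Pi.single_eq_same, Pi.single_eq_of_ne h01, zero_add, add_zero]
    · by_cases hj1 : j = i₁
      · subst hj1
        rw [hδ'₁, Pi.single_eq_of_ne hj0, Pi.single_eq_same, zero_add, zero_add]
      · rw [hδ' j hj0 hj1, Pi.single_eq_of_ne hj0, Pi.single_eq_of_ne hj1, add_zero, add_zero]
  set ψ : fermatGroup n m →* ℂˣ := fermatCharacter m θ with hψ
  have hψa : ∀ a : fermatGroup n m, ψ a =
      (a : Fin (n + 2) → ℂˣ) i₀ ^ (δ i₀).val * (a : Fin (n + 2) → ℂˣ) i₁ ^ (δ i₁).val := fun a ↦ by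
    rw [hψ, hθ, fermatCharacter_add, MonoidHom.mul_apply, fermatCharacter_single, fermatCharacter_single]
  have hχ : ∀ a : fermatGroup n m, fermatCharacter m δ a = fermatCharacter m δ' a * ψ a := fun a ↦ by
    rw [hδθ, fermatCharacter_add, MonoidHom.mul_apply]
  -- `ψ(a) = 1` when `a_{i₀} = a_{i₁}`
  let P : fermatGroup n m → Prop := fun a ↦ (a : Fin (n + 2) → ℂˣ) i₀ = (a : Fin (n + 2) → ℂˣ) i₁
  have hψP : ∀ a, P a → ψ a = 1 := by
    intro a ha
    have hpow : (a : Fin (n + 2) → ℂˣ) i₀ ^ m = 1 := mem_fermatGroup_iff.mp a.2 i₀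
    have hdvd : m ∣ (δ i₀).val + (δ i₁).val := by
      refine (ZMod.natCast_eq_zero_iff _ _).mp ?_
      push_cast
      rw [ZMod.natCast_zmod_val, ZMod.natCast_zmod_val, hsum]
    obtain ⟨q, hq⟩ := hdvd
    rw [hψa, ← ha, ← pow_add, hq, pow_mul, hpow, one_pow]
  -- expand `Λ (π_δ x)`
  intro h0
  have h1 := congrArg Λ h0
  rw [map_zero, eigenProjector_apply, map_smul, map_sum] at h1
  have hterm : ∀ a : fermatGroup n m, Λ (((fermatCharacter m δ a : ℂˣ) : ℂ)⁻¹ •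
      singularCohomology.map ℂ ℂ (diagonalMap (fermatPolynomial ℂ n m)
        (fermatGroup_le_diagonalStabilizer m a.2)) k x) =
      (((ψ a : ℂˣ) : ℂ)⁻¹ * (if P a then s else t)) • A := by
    intro a
    rw [map_smul, hΛ a, smul_smul]
    congr 1
    have hu : ((fermatCharacter m δ' a : ℂˣ) : ℂ) ≠ 0 := Units.ne_zero _
    rw [hχ a, Units.val_mul, mul_inv, mul_mul_mul_comm, inv_mul_cancel₀ hu, one_mul]
  simp_rw [hterm] at h1
  rw [← Finset.sum_smul] at h1
  -- the character sums
  have hζ := Complex.isPrimitiveRoot_exp m (NeZero.ne m)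
  set ζ : rootsOfUnity m ℂ := hζ.toRootsOfUnity with hζdef
  have hζu : IsPrimitiveRoot (ζ : ℂˣ) m :=
    IsPrimitiveRoot.coe_units_iff.mp (by simpa [hζdef] using hζ)
  have hψg : ψ (fermatGroupSingle i₀ ζ) ≠ 1 := by
    intro h
    rw [hψ, fermatCharacter_fermatGroupSingle] at h
    have hθ0 : θ i₀ = δ i₀ := by
      simp only [hθ, Pi.add_apply, Pi.single_eq_same, Pi.single_eq_of_ne h01, add_zero]
    rw [hθ0] at h
    exact hζu.pow_ne_one_of_pos_of_lt ((ZMod.val_ne_zero _).mpr hδ) (ZMod.val_lt _) h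
  have hS₀ : ∑ a : fermatGroup n m, ((ψ a : ℂˣ) : ℂ)⁻¹ * (if True then 1 else 0) = 0 :=
    sum_inv_fermatCharacter_mul_indicator_eq_zero' ψ (fun _ ↦ True) (fermatGroupSingle i₀ ζ)
      (fun _ ↦ Iff.rfl) hψg
  simp only [if_true, mul_one] at hS₀
  have hN : ∑ a : fermatGroup n m, ((ψ a : ℂˣ) : ℂ)⁻¹ * (if P a then 1 else 0) =
      ((Finset.univ.filter fun a : fermatGroup n m ↦ P a).card : ℂ) := by
    rw [Finset.natCast_card_filter]
    refine Finset.sum_congr rfl fun a _ ↦ ?_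
    by_cases ha : P a
    · rw [if_pos ha, hψP a ha]; simp
    · rw [if_neg ha]; simp
  have hNpos : ((Finset.univ.filter fun a : fermatGroup n m ↦ P a).card : ℂ) ≠ 0 := by
    rw [Nat.cast_ne_zero, ← Nat.pos_iff_ne_zero, Finset.card_pos]
    exact ⟨1, Finset.mem_filter.mpr ⟨Finset.mem_univ _, rfl⟩⟩
  have hC : ∑ a : fermatGroup n m, ((ψ a : ℂˣ) : ℂ)⁻¹ * (if P a then s else t) =
      (s - t) * ((Finset.univ.filter fun a : fermatGroup n m ↦ P a).card : ℂ) := by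
    have hexp : ∀ a : fermatGroup n m, ((ψ a : ℂˣ) : ℂ)⁻¹ * (if P a then s else t) =
        t * ((ψ a : ℂˣ) : ℂ)⁻¹ + (s - t) * (((ψ a : ℂˣ) : ℂ)⁻¹ * (if P a then 1 else 0)) := fun a ↦ by
      split_ifs <;> ring
    simp_rw [hexp]
    rw [Finset.sum_add_distrib, ← Finset.mul_sum, ← Finset.mul_sum, hS₀, hN]
    ring
  rw [hC] at h1
  -- contradiction
  have hne : ((Fintype.card (fermatGroup n m) : ℂ)⁻¹ •
      (((s - t) * ((Finset.univ.filter fun a : fermatGroup n m ↦ P a).card : ℂ)) • A)) ≠ 0 :=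
    smul_ne_zero (inv_ne_zero (Nat.cast_ne_zero.mpr Fintype.card_ne_zero))
      (smul_ne_zero (mul_ne_zero (sub_ne_zero.mpr hst) hNpos) hA)
  exact hne h1

end Literature.AlgebraicGeometry.HodgeTheory

end
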